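import Mathlib.RingTheory.SimpleModule.Rank
import Literature.AlgebraicGeometry.Motives.HodgeStructure
import HarnessLib

/-!
# Rank-one rational Hodge structures are of type `(k,k)`

A pure `ℚ`-Hodge structure of weight `n` on a **one-dimensional** `ℚ`-vector space `V` has even
weight `n = 2k` and is of Hodge type `(k,k)`: `F^k V_ℂ = V_ℂ`, `F^{k+1} V_ℂ = 0`, `V^{k,k} = V_ℂ`,
and every rational vector is a Hodge class. Reason: `V_ℂ = ℂ ⊗_ℚ V` is a simple `ℂ`-module, so
every `F^p` is `0` or `V_ℂ`, and `n`-opposedness `F^p ⊕ conj F^q = V_ℂ` (`p + q = n + 1`) excludes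
all patterns but the `(k,k)` one. This is the linear algebra behind "the Hodge structure on
`H⁰(X,ℚ)` of a connected compact Kähler manifold is the trivial Hodge structure `ℚ = ℚ(0)`" and
"the Tate twist `ℚ(-k)` is the rank-one Hodge structure of weight `2k`, of type `(k,k)`"
(Carlson–Müller-Stach–Peters, *Period Mappings and Period Domains*, 2nd ed., Examples 1.2.6
"Tate structures": "the trivial Hodge structure `ℤ` … `ℂ = ℂ^{0,0}`", "`ℤ(k)` … weight `-2k` …
`ℂ = ℂ^{-k,-k}`", "one can think of `ℤ` as the Hodge structure on `H⁰` of a point"; Voisin,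
*Hodge Theory I*, §7.1.1 for the filtration form used here). We record the lemma as [folklore]:
a two-line consequence of the definitions, not attributed to anyone.

Everything is stated for the filtration-form structure
`Literature.AlgebraicGeometry.Motives.HodgeStructure` of `HodgeStructure.lean` and proved from its
fields `antitone_F`, `isCompl_F_complexConj` and the lemmas `complexConj_top`, `complexConj_bot`;
no finite-dimensionality beyond `finrank ℚ V = 1` is used.

## Main statements

* `HodgeStructure.F_eq_bot_or_eq_top_of_finrank_eq_one`: each `F^p` is `⊥` or `⊤`.
* `HodgeStructure.F_eq_top_of_finrank_eq_one`: weight `2k` ⇒ `F^k = ⊤`.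
* `HodgeStructure.F_add_one_eq_bot_of_finrank_eq_one`: weight `2k` ⇒ `F^{k+1} = ⊥`.
* `HodgeStructure.piece_eq_top_of_finrank_eq_one`: weight `2k` ⇒ `V^{k,k} = V_ℂ`.
* `HodgeStructure.hodgeClasses_eq_top_of_finrank_eq_one`: weight `2k` ⇒ every `v : V` is a Hodge class.
* `HodgeStructure.even_of_finrank_eq_one`: the weight of a rank-one Hodge structure is even.
* `HodgeStructure.F_zero_eq_top_of_finrank_eq_one`: the weight-`0` case `F⁰ = V_ℂ` (type `(0,0)`).

Provenance: the weight-`0` case was first written (same name, same statement) in the speedrun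
package `HodgeCMPerL`, file `HodgeCM/Proofs/Pohlmann/PohlmannAllNoN4.lean` §1 (cell pub-hodgecm,
gate run 27/28, 2026-08-18), where it discharges the hypothesis "`H⁰` of a connected variety is of
type `(0,0)`"; re-homed here under the LEAN-IN-TREE rule with the general weight-`2k` form added.

## References

* J. Carlson, S. Müller-Stach, C. Peters, *Period Mappings and Period Domains*, 2nd ed.,
  Cambridge Studies in Advanced Mathematics 168 (2017), Examples 1.2.6.
  [bib: CarlsonMullerStachPeters2017]
* C. Voisin, *Hodge Theory and Complex Algebraic Geometry I* (2002), §7.1.1. [bib: VoisinHodgeI2002]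
-/

open scoped TensorProduct

noncomputable section

namespace Literature.AlgebraicGeometry.Motives.HodgeStructure

universe u

variable {V : Type u} [AddCommGroup V] [Module ℚ V] {n : ℤ}

/-- If `dim_ℚ V = 1` then `V_ℂ = ℂ ⊗_ℚ V` is a simple `ℂ`-module (`dim_ℂ V_ℂ = 1`). [folklore] -/
theorem isSimpleModule_baseChange_of_finrank_eq_one (hV : Module.finrank ℚ V = 1) :
    IsSimpleModule ℂ (ℂ ⊗[ℚ] V) :=
  isSimpleModule_iff_finrank_eq_one.mpr (by rw [Module.finrank_baseChange, hV])

/-- On a one-dimensional `V`, every step `F^p` of a Hodge filtration is `0` or all of `V_ℂ`. [folklore] -/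
theorem F_eq_bot_or_eq_top_of_finrank_eq_one (H : HodgeStructure V n)
    (hV : Module.finrank ℚ V = 1) (p : ℤ) : H.F p = ⊥ ∨ H.F p = ⊤ :=
  haveI := isSimpleModule_baseChange_of_finrank_eq_one hV
  eq_bot_or_eq_top (H.F p)

/-- A rank-one `ℚ`-Hodge structure of weight `2k` has `F^k = V_ℂ`: if `F^k = 0` then
`F^{k+1} ≤ F^k = 0`, and opposedness at `(k, k+1)` reads `0 ⊕ conj 0 = V_ℂ`, absurd. [folklore] -/
theorem F_eq_top_of_finrank_eq_one (H : HodgeStructure V n) {k : ℤ} (hn : n = 2 * k)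
    (hV : Module.finrank ℚ V = 1) : H.F k = ⊤ := by
  rcases H.F_eq_bot_or_eq_top_of_finrank_eq_one hV k with h0 | h0
  · have h1 : H.F (k + 1) = ⊥ := eq_bot_iff.mpr (h0 ▸ H.antitone_F (show k ≤ k + 1 by omega))
    have hc := H.isCompl_F_complexConj k (k + 1) (by omega)
    rw [h0, h1, complexConj_bot] at hc
    rw [h0, ← hc.sup_eq_top, bot_sup_eq]
  · exact h0

/-- A rank-one `ℚ`-Hodge structure of weight `2k` has `F^{k+1} = 0`: opposedness at `(k+1, k)`
reads `F^{k+1} ⊕ conj F^k = V_ℂ` with `conj F^k = conj V_ℂ = V_ℂ`. [folklore] -/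
theorem F_add_one_eq_bot_of_finrank_eq_one (H : HodgeStructure V n) {k : ℤ} (hn : n = 2 * k)
    (hV : Module.finrank ℚ V = 1) : H.F (k + 1) = ⊥ := by
  have hc := H.isCompl_F_complexConj (k + 1) k (by omega)
  rw [H.F_eq_top_of_finrank_eq_one hn hV, complexConj_top] at hc
  simpa only [inf_top_eq] using hc.inf_eq_bot

/-- A rank-one `ℚ`-Hodge structure of weight `2k` is of type `(k,k)`: `V^{k,k} = V_ℂ`. [folklore] -/
theorem piece_eq_top_of_finrank_eq_one (H : HodgeStructure V n) {k : ℤ} (hn : n = 2 * k)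
    (hV : Module.finrank ℚ V = 1) : H.piece k k = ⊤ := by
  rw [piece_of_add_eq H (show k + k = n by omega), H.F_eq_top_of_finrank_eq_one hn hV,
    complexConj_top, inf_top_eq]

/-- On a rank-one `ℚ`-Hodge structure of weight `2k` every rational vector is a Hodge class:
`hodgeClasses H k = V`. [folklore] -/
theorem hodgeClasses_eq_top_of_finrank_eq_one (H : HodgeStructure V n) {k : ℤ} (hn : n = 2 * k)
    (hV : Module.finrank ℚ V = 1) : H.hodgeClasses k = ⊤ := by
  refine eq_top_iff.mpr fun v _ => ?_
  rw [mem_hodgeClasses_iff, H.F_eq_top_of_finrank_eq_one hn hV]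
  exact Submodule.mem_top

/-- The weight of a rank-one `ℚ`-Hodge structure is even: for odd `n = 2k + 1`, opposedness at
`(k+1, k+1)` reads `F^{k+1} ⊕ conj F^{k+1} = V_ℂ`, impossible for `F^{k+1} ∈ {0, V_ℂ}` since
`V_ℂ ≠ 0`. (Equivalently: Hodge symmetry `h^{p,q} = h^{q,p}` makes `dim V` even in odd weight.)
[folklore] -/
theorem even_of_finrank_eq_one (H : HodgeStructure V n) (hV : Module.finrank ℚ V = 1) :
    Even n := by
  haveI := isSimpleModule_baseChange_of_finrank_eq_one hV
  rcases Int.even_or_odd n with h | ⟨k, hk⟩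
  · exact h
  · exfalso
    have hc := H.isCompl_F_complexConj (k + 1) (k + 1) (by omega)
    rcases H.F_eq_bot_or_eq_top_of_finrank_eq_one hV (k + 1) with h0 | h0
    · rw [h0, complexConj_bot] at hc
      exact (bot_ne_top : (⊥ : Submodule ℂ (ℂ ⊗[ℚ] V)) ≠ ⊤) (by simpa using hc.sup_eq_top)
    · rw [h0, complexConj_top] at hc
      exact (bot_ne_top : (⊥ : Submodule ℂ (ℂ ⊗[ℚ] V)) ≠ ⊤) (by simpa using hc.inf_eq_bot.symm)

/-- A pure `ℚ`-Hodge structure of weight `0` on a one-dimensional `ℚ`-vector space has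
`F⁰ = V_ℂ` (it is of type `(0,0)`). This is the case used for `H⁰(X, ℚ)` of a connected `X`.
[folklore] -/
theorem F_zero_eq_top_of_finrank_eq_one (H : HodgeStructure V n) (hn : n = 0)
    (hV : Module.finrank ℚ V = 1) : H.F 0 = ⊤ :=
  H.F_eq_top_of_finrank_eq_one (k := 0) (by omega) hV

end Literature.AlgebraicGeometry.Motives.HodgeStructure
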